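/-
Copyright (c) 2026 the pub-hodgecm-mathlib formalisation cell (harness21).  Prover seat hodgecm-mathlib-R90-CS-p03 (g0), R90-TF section S8 «ContSpec-n½» (dealer R90-CS-plan (g2),
deal S8-R35 (2) ∕ «=» S8-R43): the SEQUEL of F4 ★ `K2E1ChiIntertwiningScalarEulerQuotientU3` (split off under the 400-line law) — the `L(½, φ)` bookkeeping lemma of R90-C10-p07's
#3 census §A and the CM print of the unramified `χ`-scalar of `U(2,1)_{L∕L⁺}`.
-/
import Summits.HodgeConjecture.HodgeConjecture.Theorems.K2E1ChiIntertwiningScalarEulerQuotientU3   -- F4 (this seat): `exists_differentiableOn_mul_chiScalar_three`, `entire_eq_of_eqOn_one_lt_re`; brings ★ `exists_entire_eq_partialL`, ★ Literature `differentiableOn_inv_prod_mul_and_eq_heckeLFunction`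
import Summits.HodgeConjecture.HodgeConjecture.Theorems.K2E1HeckeLHalfNeZeroDefs                   -- ★ p861442 (K2-defs1): `LHalfNeZero`, `IsEntireLContinuation`, `isEntireLContinuation_continuation`
import Literature.NumberTheory.GaloisRepresentations.HeckeLFunctionEntireContinuationProofs          -- ★ `HeckeCharacter.hasEntireContinuation_heckeLFunction_of_map_posRealIdele` (Hecke–Tate: the FULL `L(s, φ)` is entire, `φ ≠ 1` ray-trivial)
import HarnessLib

/-!
# K2·E1 ∕ R90·S8 — `K2E1ChiIntertwiningScalarEulerQuotientU3CM` (sequel of file F4): `L(½, φ) ≠ 0` IN THE TREE'S CURRENCY ★ `LHalfNeZero φ` VERSUS THE `S`-PARTIAL CONTINUATION, AND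
# THE CM PRINT OF THE UNRAMIFIED `χ`-SCALAR OF `U(2,1)_{L∕L⁺}` ON `{1 < Re z}` WITH ITS MIDDLE-POLE TEST «`G(3∕2) ≠ 0 ⟺ L(½, φ) ≠ 0`»

Cell `pub/hodgecm-mathlib`, crux h413 = `stmt-HodgeConjecture-24833`, route of record `HCCMUnconditional`; R90-TF section S8 «ContSpec-n½», file B `Cruxes/H413/Lines/R90_S8_ResidualSpectrumU3B.lean`
(ED. 4: #3 `sock_S8_res_piN_occurs` :409, #2♯ `sock_S8_res_classification_sharp` :433), censuses `R90/S8/CENSUS-sock3-piN.R90-C10-p07-g0.md` §A («the S₃-scalar file must carry … the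
bookkeeping lemma «`LHalfNeZero φ ↔ g_S(½) ≠ 0`»») and `R90/S8/CENSUS-F4.R90-CS-p03-g0.md`.  THEOREMS ONLY (no `def`, no `instance`, no notation, no named-fact hypothesis, no `sorry`;
default heartbeats); lane `--supports stmt-HodgeConjecture-24833 --as helper` (count-neutral).  Closes no socket.

THE MATHEMATICS ([Rogawski1990, §13.9 p. 229 (ii)]; [TateThesis1967, Thm. 4.4.1]; [NeukirchANT1999, VII §8]).  The socket currency of «`L(½, φ) ≠ 0`» is ★ `LHalfNeZero φ` (K2-defs1,
p861442): some ∕ every ENTIRE continuation of the FULL Euler product `heckeLFunction φ = ∏_{φ unramified at v} (1 − φ(ϖ_v) N v^{−s})⁻¹` is non-zero at `½`.  File F4's pole test at the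
middle point reads `g(½) ≠ 0` for an entire continuation `g` of the `S`-PARTIAL product `L_E^S(·, φ)` (★ `exists_entire_eq_partialL`, `S ⊇` ramification, finite).  On `Re s > 1`
the two differ by the finite Euler factor `E_S(s) = ∏_{v ∈ S} (1 − c_v N v^{−s})` (`c_v = φ(ϖ_v)` at unramified `v ∈ S`, else `0`): `heckeLFunction φ = E_S⁻¹·g` (★ Literature
`differentiableOn_inv_prod_mul_and_eq_heckeLFunction`), hence `g = E_S·F` for every entire continuation `F` of the full `L`-function (identity theorem, ★ F4 `entire_eq_of_eqOn_one_lt_re`),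
and `E_S(½) ≠ 0` (`|c_v N v^{−1∕2}| < 1`, ★ `finset_prod_one_sub_mul_cpow_ne_zero`); a full continuation exists by Hecke–Tate (★ `HeckeCharacter.hasEntireContinuation_heckeLFunction_of_map_posRealIdele`).
* §1 **`lHalfNeZero_iff_partialL_continuation_ne_zero`** — `LHalfNeZero φ ⟺ g(½) ≠ 0` (any number field `E`, unitary `φ ≠ 1` trivial on `ℝ_{>0}`, finite `S` off which `φ` is unramified).
* §2 **`exists_differentiableOn_mul_chiScalar_cm_three`** — ★ F4 §4 at `E = L`, `F = L⁺ = maximalRealSubfield L` with the middle clause read through §1: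
  `η = 1 ∧ φ ≠ 1 ⟹ (G(3∕2) ≠ 0 ⟺ LHalfNeZero φ)` — in print (`s = z − 1`, `η = φ′ω_{L∕L⁺}`): «(ii) `φ′ = ω_{E∕F}`, `s = ½`, and `L(½, φ) ≠ 0`» [Rogawski1990, §13.9 p. 229]; at `φ = φ_ξ =
  ξ.bcη⁻¹ * μω` the right-hand side is EXACTLY socket #3's hypothesis `LHalfNeZero (ξ.bcη⁻¹ * μω)`.
CONSUMERS: F5 `K2E1ChiScatteringPoleDichotomyU3`, C3 `R90S8ResPiNOccursOfLetters` (#3 non-vanishing), #2♯.  HONEST SCOPE as F4 (GL₁ only; no local identification, no B2 junction).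
HONEST LABEL: HC_CM is proved only modulo the 7 printed citations (2 remaining named inputs: hLiu418 = `stmt-HodgeConjecture-24832`, h413 = `stmt-HodgeConjecture-24833`) until rung 0
closes; REL ≠ ★ ≠ BUILT; count-neutral helper; closes no socket.

## References
* [Rogawski1990] J. D. Rogawski, *Automorphic Representations of Unitary Groups in Three Variables*, Ann. of Math. Stud. 123 (1990): §13.9 p. 229 (ii), Thm. 13.3.6.
* [TateThesis1967] J. Tate, *Fourier analysis in number fields and Hecke's zeta-functions*, in Cassels–Fröhlich (1967): Thm. 4.4.1.
* [NeukirchANT1999] J. Neukirch, *Algebraic Number Theory* (1999): Ch. VII §8 (before (8.5)), Cor. (5.11).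
* [MoeglinWaldspurger1995] C. Mœglin, J.-L. Waldspurger, *Spectral Decomposition and Eisenstein Series* (1995): IV.1.11.
-/

set_option autoImplicit false
set_option linter.dupNamespace false  -- the mandated namespace repeats the summit's segment (`HodgeConjecture.HodgeConjecture`)

noncomputable section

open scoped NNReal
open Filter Topology Complex NumberField IsDedekindDomain
open Literature.NumberTheory.Automorphic Literature.NumberTheory.LFunctions Literature.NumberTheory.GaloisRepresentations
open Summit.HodgeConjecture.HodgeConjecture.Cruxes.HLiu418.K2LiuSiegelIntertwiningScalarGL1 (exists_entire_eq_partialL norm_valueAtUniformizer_le_one)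
open Summit.HodgeConjecture.HodgeConjecture.Cruxes.H413.K2E1HeckeLHalfNeZeroDefs (LHalfNeZero IsEntireLContinuation isEntireLContinuation_continuation)
open Summit.HodgeConjecture.HodgeConjecture.Cruxes.H413.K2E1ChiIntertwiningScalarEulerQuotientU3 (entire_eq_of_eqOn_one_lt_re exists_differentiableOn_mul_chiScalar_three)

namespace Summit.HodgeConjecture.HodgeConjecture.Cruxes.H413.K2E1ChiIntertwiningScalarEulerQuotientU3CM

/-! ## §1 The bookkeeping lemma: `LHalfNeZero φ` (full `L`-function) against the `S`-partial continuation -/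

section GL1

variable {E : Type} [Field E] [NumberField E] {φ : HeckeCharacter E} {S : Set (HeightOneSpectrum (𝓞 E))}

open scoped Classical in
/-- **`L(½, φ) ≠ 0 ⟺ g(½) ≠ 0` FOR THE `S`-PARTIAL CONTINUATION `g`.**  For a unitary Hecke character `φ ≠ 1` of `E` trivial on `ℝ_{>0}`, a finite `S` off which `φ` is unramified, and ANY
entire `g` with `L_E^S(w, φ) = g(w)` on `Re w > 1`: the tree's central-value predicate ★ `LHalfNeZero φ` (= «some ∕ every entire continuation of the FULL Euler product `heckeLFunction φ` is
`≠ 0` at `½`», ★ p861442) holds iff `g(½) ≠ 0`.  Proof: on `Re w > 1`, `heckeLFunction φ = E_S(w)⁻¹·g(w)` with the finite Euler factor `E_S(w) = ∏_{v ∈ S} (1 − c_v N v^{−w})`, `c_v = φ(ϖ_v)`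
or `0` (★ `differentiableOn_inv_prod_mul_and_eq_heckeLFunction`), so `g = E_S·F` for every entire continuation `F` of the full `L`-function (identity theorem), and `E_S(½) ≠ 0`
(`|c_v N v^{−1∕2}| < 1`, ★ `finset_prod_one_sub_mul_cpow_ne_zero`); the full continuation exists by Hecke–Tate (★ `HeckeCharacter.hasEntireContinuation_heckeLFunction_of_map_posRealIdele`).
This is the junction between ★ F4 §4 (c) and the socket currency `LHalfNeZero (ξ.bcη⁻¹ * μω)` of S8B#3 ∕ #2♯. [cite: Rogawski1990, §13.9 p. 229 (ii)] [cite: TateThesis1967, Thm. 4.4.1]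
[cite: NeukirchANT1999, Ch. VII §8 (8.5)] -/
theorem lHalfNeZero_iff_partialL_continuation_ne_zero (hφ : φ.IsUnitary) (hA : ∀ t : ℝ≥0ˣ, φ (posRealIdele E t) = 1) (h1 : φ ≠ 1)
    (hS : S.Finite) (hur : ∀ w ∉ S, φ.IsUnramifiedAt w)
    {g : ℂ → ℂ} (hg : Differentiable ℂ g) (hg_eq : ∀ w : ℂ, 1 < w.re → partialStandardL S (fun w => {φ.valueAtUniformizer w}) w = g w) :
    LHalfNeZero φ ↔ g (1 / 2) ≠ 0 := by
  obtain ⟨Tf, hTf⟩ : ∃ Tf : Finset (HeightOneSpectrum (𝓞 E)), (Tf : Set (HeightOneSpectrum (𝓞 E))) = S := ⟨hS.toFinset, hS.coe_toFinset⟩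
  subst hTf
  -- `g` in the raw Euler-product form
  have hg_eq' : ∀ s : ℂ, 1 < s.re → g s = ∏' v : {v : HeightOneSpectrum (𝓞 E) // v ∉ (Tf : Set (HeightOneSpectrum (𝓞 E)))},
      (1 - φ.valueAtUniformizer v.1 * ((Ideal.absNorm v.1.asIdeal : ℕ) : ℂ) ^ (-s))⁻¹ := by
    intro s hs
    rw [← hg_eq s hs]
    unfold partialStandardL
    exact tprod_congr fun v => by rw [eval_eulerPolynomial_singleton]; rfl
  -- the full `L`-function: `E(s)⁻¹ · g s = heckeLFunction φ s` on `Re s > 1`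
  obtain ⟨-, hfull⟩ := differentiableOn_inv_prod_mul_and_eq_heckeLFunction hφ Tf hur hg hg_eq'
  -- the finite Euler factor is entire and non-zero on `Re s > 0`
  have hEd : Differentiable ℂ (fun s : ℂ => ∏ v ∈ Tf, (1 - (if φ.IsUnramifiedAt v then φ.valueAtUniformizer v else 0) * ((Ideal.absNorm v.asIdeal : ℕ) : ℂ) ^ (-s))) :=
    differentiable_finset_prod_one_sub_mul_cpow Tf _
  have hE0 : ∀ s : ℂ, 0 < s.re → (∏ v ∈ Tf, (1 - (if φ.IsUnramifiedAt v then φ.valueAtUniformizer v else 0) * ((Ideal.absNorm v.asIdeal : ℕ) : ℂ) ^ (-s))) ≠ 0 :=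
    fun s hs => finset_prod_one_sub_mul_cpow_ne_zero Tf (norm_ite_valueAtUniformizer_le_one hφ) hs
  -- for every entire continuation `F` of the full `L`-function: `g = E · F`
  have key : ∀ F : ℂ → ℂ, IsEntireLContinuation φ F →
      g = fun s => (∏ v ∈ Tf, (1 - (if φ.IsUnramifiedAt v then φ.valueAtUniformizer v else 0) * ((Ideal.absNorm v.asIdeal : ℕ) : ℂ) ^ (-s))) * F s := by
    intro F hF
    refine entire_eq_of_eqOn_one_lt_re hg (hEd.mul hF.differentiable) fun s hs => ?_
    have h := hfull s hs
    rw [← hF.eq_heckeLFunction hs] at h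
    show g s = _ * F s
    rw [← h, ← mul_assoc, mul_inv_cancel₀ (hE0 s (by linarith)), one_mul]
  have hhalf : (0 : ℝ) < (1 / 2 : ℂ).re := by norm_num
  constructor
  · rintro ⟨F, hF, hF0⟩
    rw [key F hF]
    exact mul_ne_zero (hE0 _ hhalf) hF0
  · intro hg0
    have hcont := HeckeCharacter.hasEntireContinuation_heckeLFunction_of_map_posRealIdele hφ hA h1
    have hF : IsEntireLContinuation φ hcont.continuation := isEntireLContinuation_continuation hcont
    refine ⟨hcont.continuation, hF, fun hF0 => hg0 ?_⟩
    rw [key _ hF]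
    show _ * hcont.continuation (1 / 2) = 0
    rw [hF0, mul_zero]

end GL1

/-! ## §2 The CM print: `E = L`, `F = L⁺` -/

section CM

variable (L : Type) [Field L] [NumberField L]

/-- **THE CM PRINT (`U(2,1)_{L∕L⁺}`): THE UNRAMIFIED `χ`-SCALAR `c_χ^S(z) = [L_L^S(z−1,φ)·L_{L⁺}^T(2z−2,η)] ∕ [L_L^S(z,φ)·L_{L⁺}^T(2z−1,η)]` ON `{1 < Re z}`.**  For a number field `L` (a CM field
in the S8 application — the CM hypothesis is not used by this GL₁ statement) with maximal real subfield `L⁺ = maximalRealSubfield L`, a unitary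
Hecke character `φ` of `L` (the `𝔾_m(L)`-part of the Borel datum `χ = (φ, ψ)`) and a unitary Hecke character `η` of `L⁺` (`η = φ′·ω_{L∕L⁺}`, `φ′ = φ|_{𝔸_{L⁺}^×}`), both trivial on `ℝ_{>0}` and
unramified off the finite `S` resp. `T`: there is `G` holomorphic on `{1 < Re z}` with `(z − 2)(2z − 3)·c_χ^S(z) = G(z)` for `Re z > 2`, (a) `G(2) ≠ 0 ⟺ φ = 1`, (b) `η ≠ 1 ⟹ G(3∕2) = 0`,
(c) `η = 1 ∧ φ ≠ 1 ⟹ (G(3∕2) ≠ 0 ⟺ LHalfNeZero φ)` (★ F4 §4 `exists_differentiableOn_mul_chiScalar_three` + the bookkeeping lemma §1).  With `s = z − 1` this is [Rogawski1990, §13.9 p. 229]: the unramified scalar of `M(w₀, χ_s)` has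
poles on `Re s > 0` only at «(i) `φ` trivial, `s = 1`» and «(ii) `φ′ = ω_{L∕L⁺}` (⟺ `η = 1`), `s = ½`, `L(½, φ) ≠ 0`» — the pole-LOCATION half of S8B#2♯ and, at `η = 1`, the non-vanishing
input of S8B#3 (`LHalfNeZero (ξ.bcη⁻¹ * μω)` is exactly (c)'s right-hand side at `φ = φ_ξ`). [cite: Rogawski1990, §13.9 p. 229 (i)(ii)] [cite: MoeglinWaldspurger1995, IV.1.11]
[cite: TateThesis1967, Thm. 4.4.1] -/
theorem exists_differentiableOn_mul_chiScalar_cm_three {φ : HeckeCharacter L} {η : HeckeCharacter ↥(maximalRealSubfield L)}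
    {S : Set (HeightOneSpectrum (𝓞 L))} {T : Set (HeightOneSpectrum (𝓞 ↥(maximalRealSubfield L)))}
    (hφ : φ.IsUnitary) (hφA : ∀ t : ℝ≥0ˣ, φ (posRealIdele L t) = 1) (hS : S.Finite) (hurφ : ∀ w ∉ S, φ.IsUnramifiedAt w)
    (hη : η.IsUnitary) (hηA : ∀ t : ℝ≥0ˣ, η (posRealIdele ↥(maximalRealSubfield L) t) = 1) (hT : T.Finite) (hurη : ∀ v ∉ T, η.IsUnramifiedAt v) :
    ∃ G : ℂ → ℂ, DifferentiableOn ℂ G {z : ℂ | 1 < z.re} ∧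
      (∀ z : ℂ, 2 < z.re →
        (z - 2) * (2 * z - 3) *
          ((partialStandardL S (fun w => {φ.valueAtUniformizer w}) (z - 1) * partialStandardL T (fun v => {η.valueAtUniformizer v}) (2 * z - 2)) /
            (partialStandardL S (fun w => {φ.valueAtUniformizer w}) z * partialStandardL T (fun v => {η.valueAtUniformizer v}) (2 * z - 1))) = G z) ∧
      (G 2 ≠ 0 ↔ φ = 1) ∧
      (η ≠ 1 → G (3 / 2) = 0) ∧
      (η = 1 → φ ≠ 1 → (G (3 / 2) ≠ 0 ↔ LHalfNeZero φ)) := by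
  obtain ⟨G, hG, hG_eq, hG2, hG0, hG32⟩ := exists_differentiableOn_mul_chiScalar_three hφ hφA hS hurφ hη hηA hT hurη
  refine ⟨G, hG, hG_eq, hG2, hG0, fun hη1 hφ1 => ?_⟩
  -- an entire continuation `g` of `L_L^S(·, φ)` (Hecke), then ★ F4 §4 (c) + §1
  obtain ⟨g, hg, -, hg_eq⟩ := exists_entire_eq_partialL hφ hφA hφ1 hS hurφ
  rw [hG32 hη1 hφ1 g hg hg_eq, lHalfNeZero_iff_partialL_continuation_ne_zero hφ hφA hφ1 hS hurφ hg hg_eq]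

end CM

end Summit.HodgeConjecture.HodgeConjecture.Cruxes.H413.K2E1ChiIntertwiningScalarEulerQuotientU3CM

end
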